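import Summits.HubbardSuperconductivity.HubbardSuperconductivity.Theorems.AnisotropyChordTransferFibre3N1RowCheckSound
import Summits.HubbardSuperconductivity.HubbardSuperconductivity.Theorems.AnisotropyChordTransferFibre3N1RowExprB2

/-!
# Route `AnisotropyChord` / H0 rotor rung, LEVEL 2 row `N₁`: the CORRECTED cell checker `n1CellCheckC` and its soundness

The production cell checker of the ∀L ≥ 128 row `N₁`: identical to `…N1RowExprC.n1CellCheck` except that the object stage uses the
CORRECTED `B̂` bracket `B2loC/B2hiC` of `…N1RowExprB2` (the landed `B2lo/B2hi` carry a spurious factor `t` in one closed-part summand,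
found by the soundness proof `…N1RowObjB`; the tree is append-only, hence new names): `objSpecsC`, `cellFinalBoxC`,
★ `n1CellCheckC c a₁ a₂ M₂ cmin (prec, iters) : Bool`, the bookkeeping `specsVarsOkC` (`specsVarsOkC_two` by `decide`), and
★★ `n1CellCheckC_sound` — the interval-layer soundness, verbatim the argument of `…N1RowCheckSound.n1CellCheck_sound`.
Prover seat `hubbard-h0-rotor-p2` g5; helper for piece A = stmt-HubbardSuperconductivity-23918 of rung 19089
(`--supports`, helper class).  Nothing here proves superconductivity in the Hubbard model; helper definitions/lemmas of ONE
conditional reduction (the GM₃ ∀L certificate, Level-2 row `N₁`); the rotor TARGET as originally worded stays FALSE (g15 verdict).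
Mathlib + the tree only; no sorry.
-/

set_option linter.dupNamespace false
set_option autoImplicit false

open Literature.Analysis.ValidatedNumerics

namespace Summit.HubbardSuperconductivity.HubbardSuperconductivity.Theorems.AnisotropyChord.Transfer.Fibre3.L2.N1

/-! ## The corrected checker (computable) -/

/-- the five object brackets `(B̂, P̂, Â, Q̂₁, Ĵ₁)` with the CORRECTED `B̂` bracket. -/
def objSpecsC (M2 : ℕ) : List (RExpr × RExpr) :=
  [(B2loC M2, B2hiC M2), (P2lo M2, P2hi M2), (A2lo M2, A2hi M2), (Q1lo M2, Q1hi M2), (J1lo M2, J1hi M2)]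

/-- the final box of a cell (stages 1–2, corrected objects), if all enclosures succeed. -/
def cellFinalBoxC (c : L2.NamedCell) (a1 a2 : ℚ) (M2 : ℕ) (pi : ℕ × ℕ) : Option Box :=
  match cellBox c a1 a2 M2 pi with
  | none => none
  | some B =>
    match encloseObjs pi.1 pi.2 B (objSpecsC M2) with
    | none => none
    | some objs => some (finalBox B objs)

/-- ★ THE (corrected) CELL CHECK of row `N₁`: on the `(ν, a)`-cell of `c, a₁, a₂` (all `L ≥ 128` at once), `P̂ ≥ 1`, `U′ ≥ 1`
and `cmin·U′ ≤ N₁′`. -/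
def n1CellCheckC (c : L2.NamedCell) (a1 a2 : ℚ) (M2 : ℕ) (cmin : ℚ) (pi : ℕ × ℕ) : Bool :=
  match cellFinalBoxC c a1 a2 M2 pi with
  | none => false
  | some F => rexprLeOn (.neg fP) (-1) F pi && rexprLeOn (.neg UpE) (-1) F pi && rexprLeOn (marginE cmin) 0 F pi

/-- all specs mention only earlier coordinates (corrected object list). -/
def specsVarsOkC (M2 : ℕ) : Bool :=
  (((specs M2).zipIdx 16).all fun p => varsBelow p.2 p.1.1 && varsBelow p.2 p.1.2) &&
  ((objSpecsC M2).all fun p => varsBelow (16 + (specs M2).length) p.1 && varsBelow (16 + (specs M2).length) p.2)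

/-- the bookkeeping holds for `M₂ = 2`. -/
theorem specsVarsOkC_two : specsVarsOkC 2 = true := by decide +kernel

/-! ## ★ Soundness of the corrected cell check (interval layer) -/

/-- ★★ **SOUNDNESS OF `n1CellCheckC` (interval layer)** — as `n1CellCheck_sound` with the corrected object list: if the check
passes, then for every real vector `X` in the cell box on its first sixteen coordinates whose staged coordinates satisfy the specs,
and every list of five object values bracketed by `objSpecsC` at `X`, the final vector `y = finalVec X vs` satisfies `1 ≤ y₆`,
`1 ≤ U′(y)` and `cmin·U′(y) ≤ N₁′(y)`. -/
theorem n1CellCheckC_sound (c : L2.NamedCell) (a1 a2 : ℚ) (M2 : ℕ) (cmin : ℚ) (pi : ℕ × ℕ)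
    (h : n1CellCheckC c a1 a2 M2 cmin pi = true) (hv : specsVarsOkC M2 = true) (X : ℕ → ℝ) (hX : PMem (c.box a1 a2) X)
    (hsp : ∀ j (hj : j < (specs M2).length), ((specs M2)[j].1).eval X ≤ X (16 + j) ∧ X (16 + j) ≤ ((specs M2)[j].2).eval X)
    (vs : List ℝ) (hvl : vs.length = 5)
    (hob : ∀ j (hj : j < (objSpecsC M2).length) (hj' : j < vs.length),
      ((objSpecsC M2)[j].1).eval X ≤ vs[j] ∧ vs[j] ≤ ((objSpecsC M2)[j].2).eval X) :
    1 ≤ finalVec X vs 6 ∧ 1 ≤ UpE.eval (finalVec X vs) ∧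
      (cmin : ℝ) * UpE.eval (finalVec X vs) ≤ N1pE.eval (finalVec X vs) := by
  have hlen0 : (c.box a1 a2).length = 16 := by simp [L2.NamedCell.box]
  simp only [specsVarsOkC, Bool.and_eq_true] at hv
  obtain ⟨hv1, hv2⟩ := hv
  have hS : SpecsHold X (c.box a1 a2).length (specs M2) := by
    rw [hlen0]; exact specsHold_of X (specs M2) 16 hv1 hsp
  unfold n1CellCheckC cellFinalBoxC cellBox at h
  split at h
  · exact absurd h (by simp)
  · rename_i F hF
    split at hF
    · exact absurd hF (by simp)
    · rename_i B hB
      split at hF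
      · exact absurd hF (by simp)
      · rename_i objs hobjs
        simp only [Option.some.injEq] at hF
        subst hF
        obtain ⟨hPB, hlenB⟩ := extendBox_sound pi.1 pi.2 X (specs M2) _ B hB hX hS
        have hO : ObjsHold X B.length (objSpecsC M2) vs := by
          rw [hlenB, hlen0]
          exact objsHold_of X _ (objSpecsC M2) vs (by rw [hvl]; simp [objSpecsC]) hv2 hob
        have hbr := encloseObjs_sound pi.1 pi.2 hPB (objSpecsC M2) vs objs hobjs hO
        have hmem := finalBox_mem hPB (by
          rw [hlenB, hlen0]
          simp only [specs, List.length_append, List.length_cons, List.length_nil, List.length_map]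
          omega) hbr
        simp only [Bool.and_eq_true] at h
        obtain ⟨⟨hP, hU⟩, hM⟩ := h
        have eP := rexprLeOn_sound hP _ hmem
        have eU := rexprLeOn_sound hU _ hmem
        have eM := rexprLeOn_sound hM _ hmem
        simp only [RExpr.eval] at eP eU eM
        refine ⟨?_, ?_, ?_⟩
        · have : (((-1 : ℚ)) : ℝ) = -1 := by push_cast; ring
          simp only [fP, RExpr.eval] at eP
          rw [this] at eP
          linarith
        · have : (((-1 : ℚ)) : ℝ) = -1 := by push_cast; ring
          rw [this] at eU
          linarith
        · simp only [marginE, RExpr.eval, cst] at eM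
          have : (((0 : ℚ)) : ℝ) = 0 := by push_cast; ring
          rw [this] at eM
          linarith

end Summit.HubbardSuperconductivity.HubbardSuperconductivity.Theorems.AnisotropyChord.Transfer.Fibre3.L2.N1
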